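import Summits.CriticalPhenomena.Ising3DConformalLimit.Theorems.RotationJoining.Negative.FDDIsotropyFalseWithoutGibbs
import Summits.CriticalPhenomena.Ising3DConformalLimit.Theorems.RotationJoining.Negative.LineFormWithoutGibbs

/-!
# `RotationJoining` (crux stmt-CriticalPhenomena-18763), negative-side support, module 8:
# `AsymptoticFDDIsotropy` is false without Gibbs — in the picked line's own vocabulary

Module 6 (`asymptoticFDDIsotropy_false_without_gibbs`) is restated verbatim over the line's terms
`RateSplitting.normTilt / tiltCell / normAxis / axisCell / blockSum` (bridges of module 7), together with the read-back
`asymptoticFDDIsotropy_iff_lane`: the line's stub statement `Sig.stub_asymptoticFDDIsotropy = AsymptoticFDDIsotropy`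
is, word for word, the refuted body with `IsProbabilityMeasure μ` strengthened back to `μ ∈ 𝒢(β_c)`. So any proof of
that stub must use the Gibbs / cubic-symmetry input (in reshape 2 it enters through `IsRotationInvariant` of the pinned
limit). Refuter cdisprove seat (cycle 1); refutes nothing.
-/

namespace Summit.CriticalPhenomena.Ising3DConformalLimit.Theorems.RotationJoining.Negative

open MeasureTheory Filter Finset
open Literature.Probability.LatticeModels
open Summit.CriticalPhenomena.Ising3DConformalLimit.Cruxes.RotationJoining

noncomputable section

/-- READ-BACK: the line's `AsymptoticFDDIsotropy` over this lane's cells and normalisers. -/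
theorem asymptoticFDDIsotropy_iff_lane :
    RateSplitting.AsymptoticFDDIsotropy ↔
      ∀ μ ∈ isingGibbsMeasures 3 (criticalBeta 3) 0, IsTranslationInvariantMeasure μ →
        ∀ (j m : ℕ) (us : Fin j → (Fin 3 → ℤ)), (∀ i l, |us i l| ≤ m) →
          ∀ f : (Fin j → ℝ) → ℝ, LipschitzWith 1 f → (∃ B : ℝ, ∀ v, |f v| ≤ B) →
            Tendsto (fun n : ℕ =>
              (∫ σ, f (fun i => normaliser μ (rotCell₀ n m) * blockSum (rotCell n m (us i)) σ) ∂μ) -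
                ∫ σ, f (fun i => normaliser μ (axisCell₀ n) * blockSum (axisCell n (us i)) σ) ∂μ)
              atTop (nhds 0) := by
  unfold RateSplitting.AsymptoticFDDIsotropy
  simp only [normTilt_eq, normAxis_eq, tiltCell_eq_rotCell, lineAxisCell_eq, lineBlockSum_eq]

/-- **Load-bearing hypothesis of the line's stub 3a, in its own vocabulary.** `AsymptoticFDDIsotropy` with
`μ ∈ 𝒢(β_c)` weakened to `IsProbabilityMeasure μ` is false (witness `μL`, window `(0, e₀)`, test
`min(|v₀ − v₁|, 1)/2`: axis reading `0`, rotated reading `≥ 97/5000` at every `n = 3k`; module 6). -/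
theorem asymptoticFDDIsotropyLine_false_without_gibbs :
    ¬ ∀ μ : Measure (SpinConfig (Site 3)), IsProbabilityMeasure μ → IsTranslationInvariantMeasure μ →
      ∀ (j m : ℕ) (us : Fin j → (Fin 3 → ℤ)), (∀ i l, |us i l| ≤ m) →
        ∀ f : (Fin j → ℝ) → ℝ, LipschitzWith 1 f → (∃ B : ℝ, ∀ v, |f v| ≤ B) →
          Tendsto (fun n : ℕ =>
            (∫ σ, f (fun i => RateSplitting.normTilt μ n m *
                RateSplitting.blockSum (RateSplitting.tiltCell n m (us i)) σ) ∂μ) -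
              ∫ σ, f (fun i => RateSplitting.normAxis μ n *
                RateSplitting.blockSum (RateSplitting.axisCell n (us i)) σ) ∂μ)
            atTop (nhds 0) := by
  simp only [normTilt_eq, normAxis_eq, tiltCell_eq_rotCell, lineAxisCell_eq, lineBlockSum_eq]
  exact asymptoticFDDIsotropy_false_without_gibbs

end

end Summit.CriticalPhenomena.Ising3DConformalLimit.Theorems.RotationJoining.Negative
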